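import Summits.BirchSwinnertonDyer.Rank1Residual.Additive.SelectorIdentityTameThreeProofs
import Summits.BirchSwinnertonDyer.Rank1Residual.Additive.LocIrrThreeTameCubeHolds
import HarnessLib

/-!
# L-O6-cyc9 `CondExpFourUnitPartLawThree` DERIVED modulo the cited Table II conductor fact:
# `f₃ = 4 ∧ v₃(Δ_min) ∈ {6, 12} ⟹ Δ′ ≢ ±1 (mod 9)` (the Kodaira-IV row `(3,5,6)` and the II* row
# `(5,8,12)`), and the cyclic wild rows never meet the Fouquet–Wan locus (cell `b2b-bsdres`; seat
# `b2b-bsdres-x11b3-p7` GEN 7 as CROSS-CELL POOL HAND; theorems only)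

HONEST FRAMING (cell `b2b-bsdres`, run/shared/lean/b2b/bsd-rank1-residual/, verbatim in every file): the
goal of the cell is to DELETE the COMBINATION-SHAPED residual classes of the Birch–Swinnerton-Dyer formula
for ALL analytic-rank `≤ 1` elliptic curves over `ℚ` — "full BSD formula for every rank `≤ 1` curve in
class `C`" assembled STRICTLY from published theorems — so that the rank-`≤ 1` remainder becomes exactly
the CONSTRUCTION-SHAPED classes, which are TYPED (missing-input `Prop`s), NOT attempted. This is not
"finishing BSD". Lane CLASS-CLOSURE / teams o5–o6 (O6 OPEN): research routes; census output is
EVIDENCE, never a Literature fact; nothing is booked; no mark of `RESIDUAL-MAP.md` moves. This file: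
THEOREMS ONLY (no definition, no named fact, no `@[conjecture]` node, no `sorry`; net named-fact debt
`0`). The ONE published input that is not a tree theorem — the `v(N)` column of Rizzo's Table II —
enters as the EXISTING named fact `WeierstrassCurve.conductorExponent_eq_tableConductorExponentThree`
taken as an EXPLICIT HYPOTHESIS `h3` (cited, NOT discharged, NOT restated).

## What is proved (the route typed in the TARGET's own docstring)

* §1 `rizzo_tableII_condExp_eq_four` — pure bookkeeping on the transcription `Rizzo.tableII`: the
  conductor column reads `4` exactly on the reduced triples `(1,2,0)` (II*, starred), `(2,3,4)` (II),
  `(3,5,6)` (IV), `(4,6,10)` (IV*).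
* §2 `rows_of_condExpOfInvariants_eq_four` — with `v₃(Δ) ∈ {6, 12}` the shift is solved for:
  `(v₃c₄, v₃c₆, v₃Δ) = (3,5,6)` (`m = 0`) or `(5,8,12)` (the starred row after `m = 1`); the rows
  `(2,3,4)`, `(4,6,10)` have `v₃Δ ≡ 4, 10 (mod 12)`.
* §3 **`not_isPmOneModNine_of_condExp_four_of_tableII (h3) (hf : condExp W 3 = 4)
  (hv : v₃Δ_min = 6 ∨ v₃Δ_min = 12) : ¬ IsPmOneModNine (minimalDiscUnitPartThree W)`** — cc-typer-5's
  PROVED kernel `not_isPmOneModNine_of_triple` (`64·Δ′ = a³ − 3b²`, `k = 0 / 1`) on `integralModelInt W`;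
  **`condExpFourUnitPartLawThree_of_tableII (h3 : ∀ W, …) : CondExpFourUnitPartLawThree`** (TARGET
  L-O6-cyc9 of `Additive/LocIrrThreeCriteria.lean`, binders verbatim; `Addv` unused); and
  **`not_locIrr_three_of_cyclic_values_of_tableII`** — with L-O6-irr a THEOREM
  (`locIrrThreeTameCube_holds`, `Additive/LocIrrThreeTameCubeHolds.lean`) the cyclic wild rows
  (`f₃ = 4`, `v₃Δ_min ∈ {4, 6, 10, 12}`) never meet the Fouquet–Wan locus, modulo Table II only.

WORDING (EVIDENCE framing; cc-typer-5 / the o6 planners rule on `TYPED.md` / `TARGETS.md`): "L-O6-cyc9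
DERIVED modulo the cited Table II conductor column; census 1 833 / 1 833 and `LocIrr(3)` = 0 / 5 161 on
the cyclic cell stay EVIDENCE; nothing booked; no mark." NOT here: an unconditional version (route for a
sequel: the wild normal forms `exists_variableChange_b_of_kodairaSymbolAt_wild` of IV / II*, `β₆` a unit,
give `Δ/π^{6}` resp. `Δ/π^{12} ≡ −8β₄³ − πβ₆² (mod π²)` directly — needs the residue map
`𝒪_v → ℤ/9` glue); no discharge of the Table II fact.

References: O. Rizzo, Compositio Math. 136 (2003) 1–23, Table II (p. 4), §1.1–1.2 [Rizzo2003];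
I. Papadopoulos, J. Number Theory 44 (1993) (the `p = 3` table) [Papadopoulos1993]; A. Kraus,
Manuscripta Math. 69 (1990) 353–385.
-/

noncomputable section

open scoped Classical

open WeierstrassCurve Literature.NumberTheory.EllipticCurves
  Literature.NumberTheory.EllipticCurves.Rank1Residual
  Literature.NumberTheory.EllipticCurves.Rank1Residual.Typed

namespace Summit.BirchSwinnertonDyer.Rank1Residual.Additive

/-! ## §1 The rows of Table II with `v(N) = 4` -/

section Table

/-- Projection `.2` commutes with `if`. [folklore] -/
private theorem snd_ite' {α β : Type*} (P : Prop) [Decidable P] (x y : α × β) :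
    (if P then x else y).2 = if P then x.2 else y.2 := by
  split <;> rfl

/-- Projection `.1` commutes with `if`. [folklore] -/
private theorem fst_ite' {α β : Type*} (P : Prop) [Decidable P] (x y : α × β) :
    (if P then x else y).1 = if P then x.1 else y.1 := by
  split <;> rfl

/-- One step of the `if`-cascade. [folklore] -/
private theorem ite_eq_peel {α : Type*} {P : Prop} [Decidable P] {x y n : α}
    (h : (if P then x else y) = n) : (P ∧ x = n) ∨ (¬ P ∧ y = n) := by
  by_cases hP : P
  · exact Or.inl ⟨hP, by rwa [if_pos hP] at h⟩
  · exact Or.inr ⟨hP, by rwa [if_neg hP] at h⟩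

/-- One step of the `if`-cascade past a row whose value is not the target. [folklore] -/
private theorem ite_eq_peel_ne {α : Type*} {P : Prop} [Decidable P] {x y n : α} (hx : x ≠ n)
    (h : (if P then x else y) = n) : y = n := by
  rcases ite_eq_peel h with ⟨-, h⟩ | ⟨-, h⟩
  · exact absurd h hx
  · exact h

/-- **The four rows of Rizzo's Table II whose conductor column reads `v(N) = 4`**: on the reduced
triple they are `(1, 2, 0)` (II*, starred: "cannot possibly be minimal" as written — minimal after the
shift `m = 1`, i.e. `(5, 8, 12)`), `(2, 3, 4)` (II), `(3, 5, 6)` (IV), `(4, 6, 10)` (IV*). Pure case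
analysis of the transcription `Rizzo.tableII`. [cite: Rizzo2003, Table II (p. 4), column v(N)] -/
theorem rizzo_tableII_condExp_eq_four {a b : WithTop ℤ} {c c4' c6' Δ' : ℤ}
    (h : (Rizzo.tableII a b c c4' c6' Δ').2.1 = 4) :
    (a = 1 ∧ b = 2 ∧ c = 0) ∨ (a = 2 ∧ b = 3 ∧ c = 4) ∨ (a = 3 ∧ b = 5 ∧ c = 6) ∨
      (a = 4 ∧ b = 6 ∧ c = 10) := by
  unfold Rizzo.tableII at h
  dsimp only at h
  simp only [snd_ite', fst_ite'] at h
  replace h := ite_eq_peel_ne (by decide) h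
  replace h := ite_eq_peel_ne (by decide) h
  replace h := ite_eq_peel_ne (by decide) h
  obtain ⟨hc, -⟩ | ⟨-, h⟩ := ite_eq_peel h
  · exact Or.inl hc
  replace h := ite_eq_peel_ne (by decide) h
  replace h := ite_eq_peel_ne (by decide) h
  replace h := ite_eq_peel_ne (by decide) h
  replace h := ite_eq_peel_ne (by decide) h
  replace h := ite_eq_peel_ne (by decide) h
  obtain ⟨hc, -⟩ | ⟨-, h⟩ := ite_eq_peel h
  · exact Or.inr (Or.inl hc)
  replace h := ite_eq_peel_ne (by decide) h
  replace h := ite_eq_peel_ne (by decide) h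
  replace h := ite_eq_peel_ne (by decide) h
  obtain ⟨hc, -⟩ | ⟨-, h⟩ := ite_eq_peel h
  · exact Or.inr (Or.inr (Or.inl hc))
  replace h := ite_eq_peel_ne (by decide) h
  replace h := ite_eq_peel_ne (by decide) h
  replace h := ite_eq_peel_ne (by decide) h
  replace h := ite_eq_peel_ne (by decide) h
  replace h := ite_eq_peel_ne (by decide) h
  replace h := ite_eq_peel_ne (by decide) h
  replace h := ite_eq_peel_ne (by decide) h
  obtain ⟨hc, -⟩ | ⟨-, h⟩ := ite_eq_peel h
  · exact Or.inr (Or.inr (Or.inr hc))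
  replace h := ite_eq_peel_ne (by decide) h
  replace h := ite_eq_peel_ne (by decide) h
  exact absurd h (by decide)

end Table

/-! ## §2 Table II read on the invariants: `v(N) = 4 ∧ v₃Δ ∈ {6, 12}` pins the triple -/

section Invariants

/-- **`v(N) = 4` and `v₃(Δ) ∈ {6, 12}` ⟹ `(v₃c₄, v₃c₆, v₃Δ) = (3, 5, 6)` or `(5, 8, 12)`.** Of the four
`v(N) = 4` rows only `(3,5,6)` (shift `m = 0`; `m ≥ 1` would give `v₃Δ ≥ 18`) and `(1,2,0)` with
shift `m = 1` (`v₃Δ = 12m`) are compatible with `v₃Δ ∈ {6,12}`; `(2,3,4)` and `(4,6,10)` have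
`v₃Δ ≡ 4, 10 (mod 12)`. No minimality is used (the shift is solved for).
[cite: Rizzo2003, Table II (p. 4) and §1.1–1.2 (pp. 3–4)] -/
theorem rows_of_condExpOfInvariants_eq_four {c₄ c₆ Δ : ℚ} (h : Rizzo.condExpOfInvariants c₄ c₆ Δ = 4)
    (hv : padicValRat 3 Δ = 6 ∨ padicValRat 3 Δ = 12) :
    c₄ ≠ 0 ∧ c₆ ≠ 0 ∧
      ((padicValRat 3 c₄ = 3 ∧ padicValRat 3 c₆ = 5 ∧ padicValRat 3 Δ = 6) ∨
        (padicValRat 3 c₄ = 5 ∧ padicValRat 3 c₆ = 8 ∧ padicValRat 3 Δ = 12)) := by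
  unfold Rizzo.condExpOfInvariants Rizzo.ofInvariants at h
  dsimp only at h
  set m := KellockDokchitser.shift (padicValRat 3 Δ) (Rizzo.val3 c₆) (Rizzo.val3 c₄) with hm
  clear_value m
  by_cases hc4 : c₄ = 0
  · have hv4 : Rizzo.val3 c₄ = ⊤ := by simp [Rizzo.val3, hc4]
    rw [hv4, WithTop.map_top] at h
    rcases rizzo_tableII_condExp_eq_four h with ⟨ha, -, -⟩ | ⟨ha, -, -⟩ | ⟨ha, -, -⟩ | ⟨ha, -, -⟩
    · exact absurd ha WithTop.top_ne_one
    · exact absurd ha (WithTop.top_ne_ofNat 2)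
    · exact absurd ha (WithTop.top_ne_ofNat 3)
    · exact absurd ha (WithTop.top_ne_ofNat 4)
  by_cases hc6 : c₆ = 0
  · have hv6 : Rizzo.val3 c₆ = ⊤ := by simp [Rizzo.val3, hc6]
    rw [hv6, WithTop.map_top] at h
    rcases rizzo_tableII_condExp_eq_four h with ⟨-, hb, -⟩ | ⟨-, hb, -⟩ | ⟨-, hb, -⟩ | ⟨-, hb, -⟩
    · exact absurd hb (WithTop.top_ne_ofNat 2)
    · exact absurd hb (WithTop.top_ne_ofNat 3)
    · exact absurd hb (WithTop.top_ne_ofNat 5)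
    · exact absurd hb (WithTop.top_ne_ofNat 6)
  have hv4 : Rizzo.val3 c₄ = ((padicValRat 3 c₄ : ℤ) : WithTop ℤ) := by simp [Rizzo.val3, hc4]
  have hv6 : Rizzo.val3 c₆ = ((padicValRat 3 c₆ : ℤ) : WithTop ℤ) := by simp [Rizzo.val3, hc6]
  rw [hv4, hv6, WithTop.map_coe, WithTop.map_coe] at h
  refine ⟨hc4, hc6, ?_⟩
  rcases rizzo_tableII_condExp_eq_four h with
    ⟨ha, hb, hc⟩ | ⟨ha, hb, hc⟩ | ⟨ha, hb, hc⟩ | ⟨ha, hb, hc⟩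
  all_goals simp only [WithTop.coe_eq_ofNat, WithTop.coe_eq_one] at ha hb
  · right; omega
  · omega
  · left; omega
  · omega

end Invariants

/-! ## §3 L-O6-cyc9 modulo the Table II conductor fact -/

section Curves

/-- Unit part at `3` of a non-zero integer: `z = 3^{v₃ z} · u` with `3 ∤ u`. [folklore] -/
private theorem exists_eq_pow_mul_not_dvd {z : ℤ} (hz : z ≠ 0) :
    ∃ u : ℤ, z = 3 ^ padicValInt 3 z * u ∧ ¬ (3 : ℤ) ∣ u := by
  set v := padicValInt 3 z with hv
  obtain ⟨u, hu⟩ : (3 : ℤ) ^ v ∣ z := by exact_mod_cast padicValInt_dvd (p := 3) z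
  refine ⟨u, hu, ?_⟩
  rintro ⟨u', rfl⟩
  have h3 : (3 : ℤ) ^ (v + 1) ∣ z := ⟨u', by rw [hu]; ring⟩
  rcases (padicValInt_dvd_iff (p := 3) (v + 1) z).mp (by exact_mod_cast h3) with h | h
  · exact hz h
  · omega

variable (W : WeierstrassCurve ℚ) [W.IsElliptic] [W.IsGloballyMinimal]

/-- **L-O6-cyc9 per curve, modulo the Table II conductor fact.** For `W/ℚ` elliptic and globally
minimal with `f₃ = 4` and `v₃(Δ_min) ∈ {6, 12}`, GIVEN the named fact `h3` (Table II's `v(N)` column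
is the tree's conductor exponent at `3`; cited, not discharged): `Δ′ ≢ ±1 (mod 9)`. Route = the
TARGET's docstring: §2 pins `(v₃c₄, v₃c₆, v₃Δ)` to the Kodaira-IV row `(3,5,6)` or the II* row
`(5,8,12)`; then cc-typer-5's PROVED kernel `not_isPmOneModNine_of_triple` (`k = 0 / 1`) on the integral
minimal model (`64·Δ′ = a³ − 3b²`). `Addv W 3` is not needed. [cite: Rizzo2003, Table II (rows IV (3,5,6),
II* ★(1,2,0))] -/
theorem not_isPmOneModNine_of_condExp_four_of_tableII
    (h3 : W.conductorExponent_eq_tableConductorExponentThree) (hf : condExp W 3 = 4)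
    (hv : padicValInt 3 W.minimalDiscriminantInt = 6 ∨ padicValInt 3 W.minimalDiscriminantInt = 12) :
    ¬ IsPmOneModNine (minimalDiscUnitPartThree W) := by
  -- `f₃ = 4` read on Table II, `v₃Δ ∈ {6, 12}` read on `W.Δ`
  have htab : Rizzo.condExpOfInvariants W.c₄ W.c₆ W.Δ = 4 := by
    have h := h3 (placeOf 3) (ringChar_int_quot_placeOf 3)
    rw [tableConductorExponentThree_def] at h
    rw [← h]
    exact hf
  have hvQ : padicValRat 3 W.Δ = padicValInt 3 W.minimalDiscriminantInt :=
    padicValRat_Δ_eq_padicValInt_minimalDiscriminantInt W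
  have hv' : padicValRat 3 W.Δ = 6 ∨ padicValRat 3 W.Δ = 12 := by
    rcases hv with h | h
    · left; rw [hvQ, h]; rfl
    · right; rw [hvQ, h]; rfl
  obtain ⟨hc4, hc6, hrows⟩ := rows_of_condExpOfInvariants_eq_four htab hv'
  -- the integral minimal model and its unit parts
  set E := integralModelInt W with hE
  have hmap := map_integralModelInt W
  have hc₄ : W.c₄ = ((E.c₄ : ℤ) : ℚ) := by
    have h := congrArg WeierstrassCurve.c₄ hmap
    rw [map_c₄] at h; exact h.symm
  have hc₆ : W.c₆ = ((E.c₆ : ℤ) : ℚ) := by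
    have h := congrArg WeierstrassCurve.c₆ hmap
    rw [map_c₆] at h; exact h.symm
  have hC40 : E.c₄ ≠ 0 := fun h ↦ hc4 (by rw [hc₄, h, Int.cast_zero])
  have hC60 : E.c₆ ≠ 0 := fun h ↦ hc6 (by rw [hc₆, h, Int.cast_zero])
  have hva : padicValRat 3 W.c₄ = padicValInt 3 E.c₄ := by rw [hc₄, padicValRat.of_int]
  have hvb : padicValRat 3 W.c₆ = padicValInt 3 E.c₆ := by rw [hc₆, padicValRat.of_int]
  obtain ⟨a, ha, ha3⟩ := exists_eq_pow_mul_not_dvd hC40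
  obtain ⟨b, hb, hb3⟩ := exists_eq_pow_mul_not_dvd hC60
  have hD := minimalDiscriminantInt_eq_pow_mul_unitPart W
  have hrel : 1728 * W.minimalDiscriminantInt = E.c₄ ^ 3 - E.c₆ ^ 2 := E.c_relation
  rw [hva, hvb, hvQ] at hrows
  rcases hrows with ⟨h4, h6, hΔ⟩ | ⟨h4, h6, hΔ⟩
  · -- Kodaira IV row `(3, 5, 6)`: `k = 0`
    have h4' : padicValInt 3 E.c₄ = 2 * 0 + 3 := by exact_mod_cast h4
    have h6' : padicValInt 3 E.c₆ = 3 * 0 + 5 := by exact_mod_cast h6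
    have hΔ' : padicValInt 3 W.minimalDiscriminantInt = 6 * 0 + 6 := by exact_mod_cast hΔ
    exact not_isPmOneModNine_of_triple 0 hrel (h4' ▸ ha) (h6' ▸ hb) (hΔ' ▸ hD) ha3 hb3
  · -- II* row `(5, 8, 12)` (starred `(1, 2, 0)` after the shift): `k = 1`
    have h4' : padicValInt 3 E.c₄ = 2 * 1 + 3 := by exact_mod_cast h4
    have h6' : padicValInt 3 E.c₆ = 3 * 1 + 5 := by exact_mod_cast h6
    have hΔ' : padicValInt 3 W.minimalDiscriminantInt = 6 * 1 + 6 := by exact_mod_cast hΔ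
    exact not_isPmOneModNine_of_triple 1 hrel (h4' ▸ ha) (h6' ▸ hb) (hΔ' ▸ hD) ha3 hb3

/-- **L-O6-cyc9 `CondExpFourUnitPartLawThree` DERIVED, modulo the Table II conductor fact**
(cc-typer-5's TARGET in `Additive/LocIrrThreeCriteria.lean`, binders verbatim; `Addv` unused): GIVEN
the named fact for every `W/ℚ` (cited, not discharged), every elliptic, globally minimal `W` with
`Addv W 3`, `f₃ = 4`, `v₃(Δ_min) ∈ {6, 12}` has `Δ′ ≢ ±1 (mod 9)`. CENSUS 1 833 / 1 833 (o6-r1 GEN 3)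
stays EVIDENCE; nothing booked; no mark. [cite: Rizzo2003, Table II (p. 4), column v(N)] -/
theorem condExpFourUnitPartLawThree_of_tableII
    (h3 : ∀ W : WeierstrassCurve ℚ, W.conductorExponent_eq_tableConductorExponentThree) :
    CondExpFourUnitPartLawThree :=
  fun W _ _ _ hf hv => not_isPmOneModNine_of_condExp_four_of_tableII W (h3 W) hf hv

/-- **The cyclic wild rows never meet the Fouquet–Wan locus, modulo the Table II fact ALONE**: with
L-O6-irr now a THEOREM (`locIrrThreeTameCube_holds`, x11b3-p7) and L-O6-cyc9 derived above, for `W`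
additive at `3` with `f₃ = 4` and `v₃(Δ_min) ∈ {4, 6, 10, 12}` (Kodaira II, IV, IV*, II*):
`¬ LocIrr W 3` — cc-typer-5's `not_locIrr_three_of_cyclic_values` with both TARGET binders supplied
(o6-r1's census `LocIrr(3)` = 0 / 5 161 on the cyclic cell). [cite: Rizzo2003, Table II (p. 4)] -/
theorem not_locIrr_three_of_cyclic_values_of_tableII
    (h3 : ∀ W : WeierstrassCurve ℚ, W.conductorExponent_eq_tableConductorExponentThree)
    (hadd : Addv W 3) (hf : condExp W 3 = 4)
    (hv : padicValInt 3 W.minimalDiscriminantInt = 4 ∨ padicValInt 3 W.minimalDiscriminantInt = 6 ∨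
      padicValInt 3 W.minimalDiscriminantInt = 10 ∨ padicValInt 3 W.minimalDiscriminantInt = 12) :
    ¬ LocIrr W 3 :=
  not_locIrr_three_of_cyclic_values W locIrrThreeTameCube_holds
    (condExpFourUnitPartLawThree_of_tableII h3) hadd hf hv

end Curves

end Summit.BirchSwinnertonDyer.Rank1Residual.Additive

end
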